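import Summits.CriticalPhenomena.PercolationContinuityZ3.Theorems.Transplant.SkelRootSeedLaw
import Summits.CriticalPhenomena.PercolationContinuityZ3.Theorems.Transplant.SkelPhiWinChainF2
import HarnessLib

/-!
# N1 (the `{±1}` node), (R) column (N1-R-PLAN v2, NEG-SCOPE B.12/B.13): THE ROOT RESIDUE `Skel.RootOblTW` OF AN ARBITRARY ANCHORED SCHEME
# FROM A TWO-WINDOW CHAIN UNDER THE ROOT-SEED LAW — scheme-generic, window-generic assembly

`Skel.RootOblTWAt G S Δ' δr du` (the body of `RootOblTW` at one direction, `rootOblTW_iff`) and **`Skel.rootOblTWAt_of_chain₂`**: two route-free schedule frames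
`S₁` (the bridge, read through an arbitrary planar window `𝒲₁` of the root's ball window graph `winGraph G root Rπ`) and `S₂` (the long run, through `𝒲₂`), p5-g8's
two-window chain `WinChainData.chain₂`, the root-seed law `S.W0pin G (edgesIn G A) U'` with `A` the pinned seed ball (containing the root, internally path-connected, inside
the root cube) and `U'` the root world cut to the ball, the HOP as ONE link input `linkIn ↑Qp A T₀` valid for `P_q` towards `T₀ ⊆ 𝒲₁.W (S₁.core 0)` (`Skel.root_hsrc_of_pinned`),
every step region inside `U'` and OFF the seed ball (`Skel.isSubbox_W0pin_win`), kits / counts / rim excesses under the root-seed law as hypotheses, the last true target inside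
`M_{a₀}(0 + du)` — give `RootOblTWAt` with the transfer clause discharged by `KSchA.real_W0pin_le_rootLaw`.  The N1 instance (run frames, fine cells, Step-I″ hop) is
`SkelPhiRootChainN`; nothing here depends on the skeleton.
builds on p205010 (kernel theorem, internal audit signed; external expert review pending) — nothing in this file uses p205010; nothing here is a claim about the open node.
Lane `prim-bschramm`, seat `prim-bschramm-p3` (gen 9; design owner + (R) owner); helper file (`--supports stmt-CriticalPhenomena-4575 --as helper`).
[cite: KozmaNitzan2024, §4 p. 27 (G₀), p. 28 ((32) at the root), Lemma 11 (pp. 22–23), Lemma 12 (pp. 23–25)]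
-/

noncomputable section

open MeasureTheory ProbabilityTheory
open scoped ENNReal Classical

namespace Summit.CriticalPhenomena.PercolationContinuityZ3.Theorems

namespace Transplant

namespace Skel

open Literature.Probability.Percolation Literature.Probability.LatticeModels SimpleGraph GadgetSystem ProbeHistory HSiteScheme Contour KNCells
open KNCells.KSchA KNLevels ChainPlanar
open Literature.Barriers.CriticalPhenomena (graphBall mem_graphBall_self)

variable {V : Type} [DecidableEq V] [Countable V] (G : SimpleGraph V) [G.LocallyFinite] {A' : Type*}

/-! ## §1 The root obligation at one direction -/

/-- **`RootOblTW` at one direction `du`** (its body). [cite: KozmaNitzan2024, §4 p. 28 ((32) at the root)] [this work] -/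
def RootOblTWAt (S : KSchA V A') (Δ' : ℕ) (δr : ℕ → ℝ) (du : MDir) : Prop :=
  ∃ (n : ℕ) (c : V) (Rπ : ℕ) (W : Sym2 V → unitInterval)
    (s : Fin (n + 1) → KNLevels.TStep (winGraph G c Rπ)) (T' : Fin (n + 1) → Finset V) (η : ℝ),
    (∀ T : Finset V, (prodBernoulli W).real (⋃ t ∈ T, openConn S.Γ.root t) ≤
      (prodBernoulli (pinW (KNLevels.lattW G S.p) ↑(S.U₀ G) ↑(S.U₀ G))).real
        (⋃ t ∈ (↑T : Set V), openConnIn (↑(S.Γ.Q S.Γ.a₀ 0 ∪ S.Γ.Ewv S.Γ.a₀ 0 du) : Set V) S.Γ.root t)) ∧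
    (∀ i : Fin (n + 1), (s i).L.o = S.Γ.root) ∧
    (∀ i : Fin n, T' (Fin.castSucc i) ⊆ (s i.succ).L.X 0) ∧ (∀ i : Fin (n + 1), T' i ⊆ (s i).T) ∧
    (∀ i : Fin (n + 1), (s i).KitsAt W S.p Δ' (δr n)) ∧ η ≤ δr n / 2 ∧
    (∀ i : Fin (n + 1), (prodBernoulli W).real (⋃ t ∈ (s i).T \ T' i, openConn S.Γ.root t) ≤ η) ∧
    1 - δr n < (prodBernoulli W).real (s 0).L.reachB ∧
    T' (Fin.last n) ⊆ S.Γ.M S.Γ.a₀ ((0 : Site 2) + stepVec du)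

variable {G}

omit [Countable V] in
/-- `RootOblTW` is `RootOblTWAt` at every direction. [folklore] -/
theorem rootOblTW_iff {S : KSchA V A'} {Δ' : ℕ} {δr : ℕ → ℝ} : RootOblTW G S Δ' δr ↔ ∀ du, RootOblTWAt G S Δ' δr du := Iff.rfl

/-! ## §2 The assembly from a two-window chain under the root-seed law -/

/-- **THE ROOT RESIDUE AT ONE DIRECTION FROM A TWO-WINDOW CHAIN UNDER THE ROOT-SEED LAW** (scheme-generic, window-generic).  Data: a ball depth `Rπ`, the cut root world `U' := (Q_{a₀}0 ∪ E_{a₀,0,du}) ∩ B(root, Rπ)`, the pinned seed `A ⊆ U'` inside the root cube, containing the root and joining every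
vertex of it to the root inside `A`; two planar windows `𝒲₁ 𝒲₂` of `winGraph G root Rπ`, two frames `S₁ S₂`, chain data `P₁ P₂` (source the root, support `U'`); the hop
`1 − δr n < P_q(linkIn ↑Qp A T₀)`, `Qp ⊆ U'`, `T₀ ⊆ 𝒲₁.W (S₁.core 0)`; every region inside `U'` and disjoint from `A`; nonempty true targets; the cross link; counts, kits and rim
excesses under `S.W0pin G (edgesIn G A) U'` at accuracy `δr n`, `n := S₁.N + 1 + S₂.N`; the last true target inside `M_{a₀}(0 + du)`.  Then `RootOblTWAt G S Δ' δr du`.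
[cite: KozmaNitzan2024, §4 p. 28 ((32) at the root), Lemma 11 (pp. 22–23), Lemma 12 (pp. 23–25)] -/
theorem rootOblTWAt_of_chain₂ {S : KSchA V A'} {du : MDir} {Rπ : ℕ}
    -- the pinned seed (inside the root cube and the ball, containing the root, internally connected)
    {A : Finset V} (hAQ : A ⊆ S.Γ.Q S.Γ.a₀ 0) (hAπ : ∀ a ∈ A, a ∈ graphBall G S.Γ.root Rπ) (htA : S.Γ.root ∈ A)
    (hAconn : ∀ a ∈ A, PathIn G (↑A : Set V) S.Γ.root a)
    -- two windows of the root's ball window graph, two frames, chain data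
    (𝒲₁ 𝒲₂ : Skelφ.PlanarWindow (winGraph G S.Γ.root Rπ)) (S₁ S₂ : SchedFrame) (P₁ P₂ : Skelφ.WinChainData V)
    (hPo₁ : P₁.o = S.Γ.root) (hPo₂ : P₂.o = S.Γ.root)
    (hPS₁ : P₁.Sfin = (S.U0root du).filter fun y => y ∈ graphBall G S.Γ.root Rπ)
    (hPS₂ : P₂.Sfin = (S.U0root du).filter fun y => y ∈ graphBall G S.Γ.root Rπ)
    (hRim₁ : ∀ k, P₁.Rim k ⊆ 𝒲₁.stepDF S₁ k) (hRim₂ : ∀ k, P₂.Rim k ⊆ 𝒲₂.stepDF S₂ k)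
    (hRl₁ : P₁.Rlev + 1 ≤ S₁.R') (hRl₂ : P₂.Rlev + 1 ≤ S₂.R') (hj₁ : P₁.j₁ ≤ P₁.Rlev) (hj₂ : P₂.j₁ ≤ P₂.Rlev)
    (hTne₁ : ∀ k ≤ S₁.N, (𝒲₁.coreTF S₁ k).Nonempty) (hTne₂ : ∀ k ≤ S₂.N, (𝒲₂.coreTF S₂ k).Nonempty)
    -- the rooms: regions inside the cut root world, off the pinned seed; the cross link; the last core inside `M_{a₀}(0+du)`
    (hDU₁ : ∀ k ≤ S₁.N, 𝒲₁.stepDF S₁ k ⊆ (S.U0root du).filter fun y => y ∈ graphBall G S.Γ.root Rπ)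
    (hDU₂ : ∀ k ≤ S₂.N, 𝒲₂.stepDF S₂ k ⊆ (S.U0root du).filter fun y => y ∈ graphBall G S.Γ.root Rπ)
    (hDA₁ : ∀ k ≤ S₁.N, Disjoint (𝒲₁.stepDF S₁ k) A) (hDA₂ : ∀ k ≤ S₂.N, Disjoint (𝒲₂.stepDF S₂ k) A)
    (hx : 𝒲₁.coreTF S₁ S₁.N ⊆ 𝒲₂.W (S₂.core 0))
    (hlast : 𝒲₂.coreTF S₂ S₂.N ⊆ S.Γ.M S.Γ.a₀ ((0 : Site 2) + stepVec du))
    -- the hop: ONE link input valid for `P_q`, prism inside the world, target inside the first level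
    {Δ' : ℕ} {δr : ℕ → ℝ} {η : ℝ} {Qp T₀ : Finset V}
    (hlink : 1 - δr (S₁.N + 1 + S₂.N) < (bondPercolation G S.p).real (linkIn (↑Qp : Set V) A T₀))
    (hQU : Qp ⊆ (S.U0root du).filter fun y => y ∈ graphBall G S.Γ.root Rπ) (hT₀ : T₀ ⊆ 𝒲₁.W (S₁.core 0))
    -- analytic inputs under the root-seed law, accuracy `δr n`
    (hcount₁ : 1 / (1 - (S.p : ℝ)) ^ (Δ' * P₁.N) ≤ δr (S₁.N + 1 + S₂.N) * ((Finset.Icc P₁.j₀ P₁.j₁).card : ℝ))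
    (hcount₂ : 1 / (1 - (S.p : ℝ)) ^ (Δ' * P₂.N) ≤ δr (S₁.N + 1 + S₂.N) * ((Finset.Icc P₂.j₀ P₂.j₁).card : ℝ))
    (hkits₁ : ∀ k ≤ S₁.N, ∀ j ∈ Finset.Icc P₁.j₀ P₁.j₁, ∃ (σ : SData V) (Sz : Finset V),
      SHyp (P₁.stepLF 𝒲₁ S₁ k) j σ ∧ σ.N ≤ P₁.N ∧
      (1 - (S.p : ℝ) ^ σ.sB) ^ σ.k ≤ δr (S₁.N + 1 + S₂.N) ∧ Sz ⊆ (P₁.stepLF 𝒲₁ S₁ k).X j ∧ Sz ⊆ 𝒲₁.stepDF S₁ k ∧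
      (∀ x ∈ σ.K, ∀ e' ∈ σ.seed x, e' ∉ wireSet (↑Sz : Set V)) ∧ (∀ x ∈ σ.K, σ.face x ⊆ Sz) ∧
      (∀ x ∈ σ.K, 1 - 3 * δr (S₁.N + 1 + S₂.N) ≤ (prodBernoulli (S.W0pin G (edgesIn G A) ((S.U0root du).filter fun y => y ∈ graphBall G S.Γ.root Rπ))).real
        {ω | ∃ u ∈ σ.face x, 1 - δr (S₁.N + 1 + S₂.N) <
          (prodBernoulli (pinW (S.W0pin G (edgesIn G A) ((S.U0root du).filter fun y => y ∈ graphBall G S.Γ.root Rπ)) (wireSet (↑Sz : Set V)) ω)).real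
            (⋃ t' ∈ P₁.coreEF 𝒲₁ S₁ k, openConnIn (↑(𝒲₁.stepDF S₁ k) : Set V) u t')}))
    (hkits₂ : ∀ k ≤ S₂.N, ∀ j ∈ Finset.Icc P₂.j₀ P₂.j₁, ∃ (σ : SData V) (Sz : Finset V),
      SHyp (P₂.stepLF 𝒲₂ S₂ k) j σ ∧ σ.N ≤ P₂.N ∧
      (1 - (S.p : ℝ) ^ σ.sB) ^ σ.k ≤ δr (S₁.N + 1 + S₂.N) ∧ Sz ⊆ (P₂.stepLF 𝒲₂ S₂ k).X j ∧ Sz ⊆ 𝒲₂.stepDF S₂ k ∧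
      (∀ x ∈ σ.K, ∀ e' ∈ σ.seed x, e' ∉ wireSet (↑Sz : Set V)) ∧ (∀ x ∈ σ.K, σ.face x ⊆ Sz) ∧
      (∀ x ∈ σ.K, 1 - 3 * δr (S₁.N + 1 + S₂.N) ≤ (prodBernoulli (S.W0pin G (edgesIn G A) ((S.U0root du).filter fun y => y ∈ graphBall G S.Γ.root Rπ))).real
        {ω | ∃ u ∈ σ.face x, 1 - δr (S₁.N + 1 + S₂.N) <
          (prodBernoulli (pinW (S.W0pin G (edgesIn G A) ((S.U0root du).filter fun y => y ∈ graphBall G S.Γ.root Rπ)) (wireSet (↑Sz : Set V)) ω)).real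
            (⋃ t' ∈ P₂.coreEF 𝒲₂ S₂ k, openConnIn (↑(𝒲₂.stepDF S₂ k) : Set V) u t')}))
    (hη : η ≤ δr (S₁.N + 1 + S₂.N) / 2)
    (hexc₁ : ∀ k ≤ S₁.N, (prodBernoulli (S.W0pin G (edgesIn G A) ((S.U0root du).filter fun y => y ∈ graphBall G S.Γ.root Rπ))).real
      (⋃ t' ∈ P₁.Rim k, openConn S.Γ.root t') ≤ η)
    (hexc₂ : ∀ k ≤ S₂.N, (prodBernoulli (S.W0pin G (edgesIn G A) ((S.U0root du).filter fun y => y ∈ graphBall G S.Γ.root Rπ))).real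
      (⋃ t' ∈ P₂.Rim k, openConn S.Γ.root t') ≤ η) :
    RootOblTWAt G S Δ' δr du := by
  set U' : Finset V := (S.U0root du).filter fun y => y ∈ graphBall G S.Γ.root Rπ with hU'
  set F : Finset (Sym2 V) := edgesIn G A with hF
  set W : Sym2 V → unitInterval := S.W0pin G F U' with hW
  set n : ℕ := S₁.N + 1 + S₂.N with hn
  -- the seed: its pairs are cube edges, its vertices lie in the cut world
  have hFA : ∀ e ∈ F, ∀ w ∈ e, w ∈ A := fun e he w hw => ((mem_edgesIn_iff).1 he).2 w hw
  have hFU₀ : F ⊆ S.U₀ G := by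
    intro e he
    rw [KSchA.U₀, mem_edgesIn_iff]
    obtain ⟨heG, heA⟩ := (mem_edgesIn_iff).1 he
    exact ⟨heG, fun x hx => hAQ (heA x hx)⟩
  have hAU : A ⊆ U' := fun a ha => Finset.mem_filter.2 ⟨Finset.mem_union_left _ (hAQ ha), hAπ a ha⟩
  have hrootU : S.Γ.root ∈ U' := hAU htA
  have hU'sub : U' ⊆ S.U0root du := Finset.filter_subset _ _
  -- subbox regions (off the seed), the source off the regions
  have hfresh : ∀ {Dd : Finset V}, Disjoint Dd A → ∀ u ∈ Dd, ∀ z, s(u, z) ∉ F := fun hdis => KSchA.fresh_of_disjoint hFA hdis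
  have hsub₁ : ∀ k ≤ S₁.N, IsSubbox (winGraph G S.Γ.root Rπ) W S.p (𝒲₁.stepDF S₁ k) :=
    fun k hk => isSubbox_W0pin_win (S := S) S.Γ.root Rπ (U := S.U0root du) (hDU₁ k hk) (hfresh (hDA₁ k hk))
  have hsub₂ : ∀ k ≤ S₂.N, IsSubbox (winGraph G S.Γ.root Rπ) W S.p (𝒲₂.stepDF S₂ k) :=
    fun k hk => isSubbox_W0pin_win (S := S) S.Γ.root Rπ (U := S.U0root du) (hDU₂ k hk) (hfresh (hDA₂ k hk))
  have ho₁ : ∀ k ≤ S₁.N, P₁.o ∉ 𝒲₁.stepDF S₁ k := fun k hk h' => by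
    rw [hPo₁] at h'; exact Finset.disjoint_left.1 (hDA₁ k hk) h' htA
  have ho₂ : ∀ k ≤ S₂.N, P₂.o ∉ 𝒲₂.stepDF S₂ k := fun k hk h' => by
    rw [hPo₂] at h'; exact Finset.disjoint_left.1 (hDA₂ k hk) h' htA
  -- the two-window chain
  have hC := Skelφ.WinChainData.chain₂ P₁ P₂ 𝒲₁ 𝒲₂ S₁ S₂ (hPo₂.trans hPo₁.symm) hRl₁ hRim₁ hTne₁ hRl₂ hRim₂ hTne₂ hx
    (p := S.p) (W' := W) (Δ' := Δ') (δ := δr n) (η := η)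
    hsub₁ (by rw [hPS₁]; exact KSchA.finSupp_W0pin) (fun k hk => by rw [hPS₁]; exact hDU₁ k hk) ho₁ (by rw [hPo₁, hPS₁]; exact hrootU) hj₁
    hcount₁ hkits₁ (fun k hk => by rw [hPo₁]; exact hexc₁ k hk)
    hsub₂ (by rw [hPS₂]; exact KSchA.finSupp_W0pin) (fun k hk => by rw [hPS₂]; exact hDU₂ k hk) ho₂ (by rw [hPo₂, hPS₂]; exact hrootU) hj₂
    hcount₂ hkits₂ (fun k hk => by rw [hPo₁]; exact hexc₂ k hk)
  obtain ⟨ho, hlinkC, hsubC, hkitsC, hexcC, h0, hlastC⟩ := hC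
  -- the hop under the root-seed law
  have hwired : ∀ u ∈ A, ∀ u' ∈ A, G.Adj u u' → s(u, u') ∈ F := fun u hu u' hu' hadj =>
    (mem_edgesIn_iff).2 ⟨(SimpleGraph.mem_edgeSet G).2 hadj, fun x hx => by
      rcases Sym2.mem_iff.1 hx with rfl | rfl
      · exact hu
      · exact hu'⟩
  have hsrc : 1 - δr n < (prodBernoulli W).real (⋃ t' ∈ T₀, openConn S.Γ.root t') :=
    root_hsrc_of_pinned (S := S) hlink hQU hAU subset_rfl hAconn hwired
  refine ⟨n, S.Γ.root, Rπ, W, fun i => Skelφ.WinChainData.stepAF₂ P₁ P₂ 𝒲₁ 𝒲₂ S₁ S₂ i, fun i => Skelφ.WinChainData.coreTF₂ 𝒲₁ 𝒲₂ S₁ S₂ i, η,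
    fun T => KSchA.real_W0pin_le_rootLaw hFU₀ hU'sub hrootU T, fun i => (ho i).trans hPo₁, hlinkC, hsubC, hkitsC, hη,
    fun i => by have h := hexcC i; rw [hPo₁] at h; exact h, ?_, ?_⟩
  · -- the source bound: `T₀ ⊆ X^{(0)}_0 = 𝒲₁.W (S₁.core 0)`
    refine hsrc.trans_le (measureReal_mono ?_ (measure_ne_top _ _))
    intro ω hω
    simp only [Set.mem_iUnion, exists_prop] at hω
    obtain ⟨t', ht', hωt⟩ := hω
    have ht'' : t' ∈ (Skelφ.WinChainData.stepAF₂ P₁ P₂ 𝒲₁ 𝒲₂ S₁ S₂ ((0 : Fin (n + 1)) : ℕ)).L.X 0 := by rw [h0]; exact hT₀ ht'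
    have hoo : (Skelφ.WinChainData.stepAF₂ P₁ P₂ 𝒲₁ 𝒲₂ S₁ S₂ ((0 : Fin (n + 1)) : ℕ)).L.o = S.Γ.root := (ho 0).trans hPo₁
    show ω ∈ (Skelφ.WinChainData.stepAF₂ P₁ P₂ 𝒲₁ 𝒲₂ S₁ S₂ ((0 : Fin (n + 1)) : ℕ)).L.reachB
    rw [LData.reachB, hoo]
    exact Set.mem_biUnion (Finset.mem_coe.2 ht'') hωt
  · -- the last true target enters `M_{a₀}(0 + du)`
    rw [hlastC]; exact hlast

end Skel

end Transplant

end Summit.CriticalPhenomena.PercolationContinuityZ3.Theorems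

end
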